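import Mathlib.Algebra.BigOperators.Ring.Finset
import Mathlib.Algebra.Order.BigOperators.Ring.Finset
import Mathlib.Data.Fintype.BigOperators
import Mathlib.Algebra.BigOperators.Field
import Mathlib.Algebra.BigOperators.Option
import Mathlib.Data.Real.Basic
import Mathlib.Tactic.Linarith
import Mathlib.Tactic.Ring
import Mathlib.Tactic.FieldSimp
import Mathlib.Tactic.Positivity
import Mathlib.Tactic.LinearCombination
import HarnessLib

/-!
# The block law of the Rossman–Servedio–Tan random projections (`R_init` and `R(τ)` on one block)

B. Rossman, R. A. Servedio, L.-Y. Tan, *An average-case depth hierarchy theorem for Boolean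
circuits*, arXiv:1504.03398 [RossmanServedioTan2015], §7.2: Definition 6 (p. 16, the initial
random projection `R_init`) and Definition 9 (p. 17–18, the subsequent random projections `R(τ)`,
with `q_a := ((1 - t_k)^{|S_a|} - λ)/t_{k-1}`, eq. (13)); §8, Lemmas 2 and 3 (pp. 20–21, the block computations showing that filling the stars of a
random block by an independent biased bit gives back a product distribution); §9.5 (p. 27–28, the
probability mass functions "Fact 5"/"Fact 6" and the weight ratios (18)).

Both `R_init` and `R(τ)` act INDEPENDENTLY on the blocks `a` (the children of one gate), and on a
block they are the same three-branch law: writing `∘` for the non-controlling value `o` of the gate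
(`1` for `∧`, `0` for `∨`), `•` for `!o`, `S` for the starred positions of the block `τ_a` of the
restriction being refined (`|S| = n`), `t` for the star/bullet probability, `t'` for the bias of the
bit that will later fill the stars, and `q := ((1-t)^n - λ)/t'`:

* (case 2: `τ_a ∈ {⋆, ∘}^w`, `n ≥ 1`, `n` acceptable) all stars `↦ ∘` with probability `λ`;
  stars `↦ {⋆_t, ∘_{1-t}}^S ∖ {∘^S}` with total probability `q`; stars `↦ {•_t, ∘_{1-t}}^S ∖ {∘^S}`
  with total probability `1 - λ - q` (RST Def. 9, second bullet, eq. (12));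
* (case 1: otherwise) stars `↦ {•_t, ∘_{1-t}}^S` (RST Def. 9, first bullet).

`R_init` (RST Def. 6) is the case `τ = ⋆^{A × [m]}`, `o = 1`, `t = 1/2`, `t' = t_{d-1}`, every size
acceptable: then `q = (2^{-m} - λ)/t_{d-1} = (p - λ)/t_{d-1}` is RST's `q` (eq. (11): `t_{d-1} =
(p - λ)/q`) and the three branches are `{1}^m` w.p. `λ`, uniform on `{⋆,1}^m ∖ {1^m}` w.p. `q`,
uniform on `{0,1}^m ∖ {1^m}` w.p. `1 - λ - q`.

## Contents (everything proved; no probability theory, only finite sums)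

* `BlockLaw` (parameters `o, t, t', lam, acc`), `BlockLaw.ζ L τa ϱ` — the weight of the refinement
  `ϱ` of the block `τa : Fin w → Option Bool`, written as a linear combination of PRODUCT weights
  `prodW` so that all sums are instances of `∏ Σ = Σ ∏`;
* `sum_ζ` (`Σ_ϱ ζ = 1`), `ζ_nonneg`, the values on the three branches (`ζ_allo`, `ζ_of_star`,
  `ζ_of_total`), the support facts (`refines_of_ζ_ne_zero`, `case2_of_ζ_ne_zero_of_star`,
  `no_bullet_of_ζ_ne_zero_of_star` = hypothesis (support) of the projection switching lemma), the
  weight ratios `ratio_of_star` (= hypothesis (ratio) of the projection switching lemma, RST (18));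
* `coupling` — RST's Lemmas 2 and 3 of §8 on one block:
  `Σ_ϱ ζ(ϱ) · P_b[fill(ϱ, b) = z] = {•_t, ∘_{1-t}}^S(z)` for the independent bit `b` with
  `P[b = ∘] = t'`, which is where `q t' = (1-t)^n - λ` is used.

The per-level assembly (product over blocks, lifts, the parameters `t_k`, acceptability
`|S| = qw ± w^{β(k,d)}`) is done in the sibling files; here `o, t, t', lam, acc` are arbitrary.

Numbering of Definitions / Lemmas / Remarks / Facts follows the arXiv text as materialised by
`lit read arxiv:1504.03398` (global counters: Definition 6 = `R_init`, Definition 8 = acceptable,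
Definition 9 = `R(τ)`, Remark 3 = "`q_a ∈ [0,1]`", Remark 4 = dead blocks, Lemmas 2–3 = the
block computations of §8, Facts 5–6 = the mass functions of §9.5); sections and pages are given
with every citation.
-/

noncomputable section

namespace Literature.Computability.Complexity

namespace RSTProj

open Finset

/-! ### Product weights on the refinements of a block -/

section ProdW

variable {w : ℕ}

/-- The starred positions `S = τ_a^{-1}(⋆)` of a block. [cite: RossmanServedioTan2015, §7.2 Def. 9 (p. 17, `S_a`)] -/
def stars (τa : Fin w → Option Bool) : Finset (Fin w) := univ.filter fun i => τa i = none

/-- Membership in `stars`. [folklore] -/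
@[simp] theorem mem_stars {τa : Fin w → Option Bool} {i : Fin w} : i ∈ stars τa ↔ τa i = none := by
  simp [stars]

/-- `ϱ` refines the block `τa` (agrees with it on its fixed positions). [cite: RossmanServedioTan2015, §5.3 Def. 2 (p. 13, refinement)] -/
def Refines (ϱ τa : Fin w → Option Bool) : Prop := ∀ i, τa i ≠ none → ϱ i = τa i

/-- The product weight with letter weights `Lf` on the stars of `τa` and the indicator of agreement
with `τa` elsewhere: `∏_{i ∈ S} Lf(ϱ_i) · [ϱ = τa off S]`. [folklore] -/
def prodW (τa : Fin w → Option Bool) (Lf : Option Bool → ℝ) (ϱ : Fin w → Option Bool) : ℝ :=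
  ∏ i, (if τa i = none then Lf (ϱ i) else if ϱ i = τa i then 1 else 0)

/-- **`Σ ∏ = ∏ Σ`**: the total product weight is `(Σ_c Lf c)^{|S|}`. [folklore] -/
theorem sum_prodW (τa : Fin w → Option Bool) (Lf : Option Bool → ℝ) :
    ∑ ϱ : Fin w → Option Bool, prodW τa Lf ϱ = (∑ c : Option Bool, Lf c) ^ (stars τa).card := by
  classical
  have h := Finset.prod_univ_sum (fun (_ : Fin w) => (univ : Finset (Option Bool)))
    (fun i c => if τa i = none then Lf c else if c = τa i then 1 else 0)
  simp only [Fintype.piFinset_univ] at h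
  unfold prodW
  rw [← h]
  have key : ∀ i : Fin w, ∑ c : Option Bool, (if τa i = none then Lf c else if c = τa i then 1 else 0) =
      if τa i = none then ∑ c : Option Bool, Lf c else 1 := by
    intro i
    split_ifs with hi
    · rfl
    · rw [Finset.sum_ite_eq' univ (τa i) (fun _ => (1 : ℝ))]; simp
  rw [Finset.prod_congr rfl fun i _ => key i, Finset.prod_ite, Finset.prod_const, Finset.prod_const_one,
    mul_one]
  rfl

/-- A non-refinement has product weight `0`. [folklore] -/
theorem prodW_eq_zero_of_not_refines {τa ϱ : Fin w → Option Bool} (h : ¬ Refines ϱ τa) (Lf : Option Bool → ℝ) :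
    prodW τa Lf ϱ = 0 := by
  classical
  unfold Refines at h
  push Not at h
  obtain ⟨i, hi, hne⟩ := h
  exact Finset.prod_eq_zero (Finset.mem_univ i) (by rw [if_neg hi, if_neg hne])

/-- The product weight of a refinement is the product of the letter weights over the stars. [folklore] -/
theorem prodW_of_refines {τa ϱ : Fin w → Option Bool} (h : Refines ϱ τa) (Lf : Option Bool → ℝ) :
    prodW τa Lf ϱ = ∏ i ∈ stars τa, Lf (ϱ i) := by
  classical
  unfold prodW
  rw [Finset.prod_ite, Finset.prod_congr rfl fun i hi => if_pos (h i (Finset.mem_filter.1 hi).2),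
    Finset.prod_const_one, mul_one]
  rfl

/-- A star of a refinement with nonzero product weight has nonzero letter weight. [folklore] -/
theorem prodW_eq_zero_of_letter {τa ϱ : Fin w → Option Bool} {Lf : Option Bool → ℝ} {i : Fin w}
    (hi : τa i = none) (h0 : Lf (ϱ i) = 0) : prodW τa Lf ϱ = 0 := by
  classical
  exact Finset.prod_eq_zero (Finset.mem_univ i) (by rw [if_pos hi, h0])

/-- Product weights with nonnegative letters are nonnegative. [folklore] -/
theorem prodW_nonneg (τa : Fin w → Option Bool) {Lf : Option Bool → ℝ} (hL : ∀ c, 0 ≤ Lf c)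
    (ϱ : Fin w → Option Bool) : 0 ≤ prodW τa Lf ϱ :=
  Finset.prod_nonneg fun i _ => by split_ifs <;> first | exact hL _ | norm_num

end ProdW

/-! ### The block law -/

/-- The parameters of the law of one block of an RST random projection: the non-controlling value
`o` (`∘`) of the gate whose children form the block, the star/bullet probability `t` (`t_k`; `1/2`
for `R_init`), the bias `t'` of the bit filling the stars later (`t_{k-1}`), `λ`, and the
acceptability predicate on the number of stars of the block (RST Def. 8; always true for `R_init`).
[cite: RossmanServedioTan2015, §7.2 Defs. 6, 8, 9 (pp. 16–18)] -/
structure BlockLaw where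
  /-- the non-controlling value `∘` of the block's gate (`true` for `∧`) -/
  o : Bool
  /-- the probability of `⋆` (second branch) / of `•` (third branch) at a starred position -/
  t : ℝ
  /-- the bias towards `∘` of the bit that later fills the stars -/
  t' : ℝ
  /-- `λ`, the probability of the all-`∘` branch -/
  lam : ℝ
  /-- acceptability of the number of stars (RST Def. 8) -/
  acc : ℕ → Bool

namespace BlockLaw

variable (L : BlockLaw) {w : ℕ}

/-- `q_a := ((1 - t)^{|S_a|} - λ)/t'` (RST eq. (13); for `R_init`, `t = 1/2`, `|S| = m`, this is
`(p - λ)/t_{d-1} = q`). [cite: RossmanServedioTan2015, §7.2 Def. 9 (p. 18, eq. (13))] -/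
def qa (n : ℕ) : ℝ := ((1 - L.t) ^ n - L.lam) / L.t'

/-- Letter weights of the starred branch `{⋆_t, ∘_{1-t}}` (no `•`). [cite: RossmanServedioTan2015, §7.2 Def. 9 (p. 18, eq. (12), second line)] -/
def L2 : Option Bool → ℝ
  | none => L.t
  | some b => if b = L.o then 1 - L.t else 0

/-- Letter weights of the bullet branch `{•_t, ∘_{1-t}}` (no `⋆`). [cite: RossmanServedioTan2015, §7.2 Def. 9 (p. 18, eq. (12), third line)] -/
def L3 : Option Bool → ℝ
  | none => 0
  | some b => if b = L.o then 1 - L.t else L.t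

/-- The all-`∘` refinement of the block (every star set to `∘`). [cite: RossmanServedioTan2015, §7.2 Def. 9 (p. 18, eq. (12), first line)] -/
def allo (τa : Fin w → Option Bool) : Fin w → Option Bool := fun i => some ((τa i).getD L.o)

/-- The second bullet of RST Def. 9 applies: the block has no `•`, at least one star, and an
acceptable number of stars. [cite: RossmanServedioTan2015, §7.2 Def. 9 (p. 18)] -/
def Case2 (τa : Fin w → Option Bool) : Prop :=
  (∀ i, τa i ≠ some (!L.o)) ∧ L.acc (stars τa).card = true ∧ (stars τa).card ≠ 0

/-- Decidability of `Case2`. [folklore] -/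
instance (τa : Fin w → Option Bool) : Decidable (L.Case2 τa) :=
  inferInstanceAs (Decidable (_ ∧ _ ∧ _))

/-- The indicator of the all-`∘` refinement. [folklore] -/
def ind (τa ϱ : Fin w → Option Bool) : ℝ := if ϱ = L.allo τa then 1 else 0

/-- **The law of one block** (RST Def. 6 / Def. 9, with the probability mass functions of §9.5): in
case 2, `λ` on the all-`∘` refinement, the `{⋆_t,∘_{1-t}}`-product law minus its all-`∘` atom
rescaled to total mass `q`, and the `{•_t,∘_{1-t}}`-product law minus its all-`∘` atom rescaled to
total mass `1 - λ - q`; in case 1 the `{•_t,∘_{1-t}}`-product law. Written with product weights so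
that every sum factorises. [cite: RossmanServedioTan2015, §7.2 Def. 9 (p. 18) and §9.5 Fact 5 (p. 27)] -/
def ζ (τa ϱ : Fin w → Option Bool) : ℝ :=
  if L.Case2 τa then
    L.lam * L.ind τa ϱ
    + L.qa (stars τa).card / (1 - (1 - L.t) ^ (stars τa).card) *
        (prodW τa L.L2 ϱ - (1 - L.t) ^ (stars τa).card * L.ind τa ϱ)
    + (1 - L.lam - L.qa (stars τa).card) / (1 - (1 - L.t) ^ (stars τa).card) *
        (prodW τa L.L3 ϱ - (1 - L.t) ^ (stars τa).card * L.ind τa ϱ)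
  else prodW τa L.L3 ϱ

/-! #### Elementary evaluations -/

/-- The starred letters sum to `1`. [folklore] -/
theorem sum_L2 : ∑ c : Option Bool, L.L2 c = 1 := by
  rw [Fintype.sum_option, Fintype.sum_bool]
  cases ho : L.o <;> simp [L2, ho]

/-- The bullet letters sum to `1`. [folklore] -/
theorem sum_L3 : ∑ c : Option Bool, L.L3 c = 1 := by
  rw [Fintype.sum_option, Fintype.sum_bool]
  cases ho : L.o <;> simp [L3, ho]

/-- The all-`∘` string refines the block. [folklore] -/
theorem allo_refines (τa : Fin w → Option Bool) : Refines (L.allo τa) τa := by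
  intro i hi
  unfold allo
  cases h : τa i with
  | none => exact absurd h hi
  | some b => rfl

/-- Value of `allo` on a star. [folklore] -/
theorem allo_of_none {τa : Fin w → Option Bool} {i : Fin w} (hi : τa i = none) : L.allo τa i = some L.o := by
  simp [allo, hi]

/-- Product weight of the all-`∘` string. [folklore] -/
theorem prodW_allo (τa : Fin w → Option Bool) {Lf : Option Bool → ℝ} :
    prodW τa Lf (L.allo τa) = Lf (some L.o) ^ (stars τa).card := by
  rw [prodW_of_refines (L.allo_refines τa), Finset.prod_congr rfl fun i hi => by rw [L.allo_of_none (mem_stars.1 hi)],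
    Finset.prod_const]

/-- `L2` of the all-`∘` string. [folklore] -/
theorem prodW_L2_allo (τa : Fin w → Option Bool) : prodW τa L.L2 (L.allo τa) = (1 - L.t) ^ (stars τa).card := by
  rw [L.prodW_allo]; simp [L2]

/-- `L3` of the all-`∘` string. [folklore] -/
theorem prodW_L3_allo (τa : Fin w → Option Bool) : prodW τa L.L3 (L.allo τa) = (1 - L.t) ^ (stars τa).card := by
  rw [L.prodW_allo]; simp [L3]

/-- **Total mass one** (`ζ` is a probability mass function on the refinements of the block), for
`0 < t ≤ 1` (so that `(1-t)^n < 1` in case 2). [cite: RossmanServedioTan2015, §7.2 Def. 9 and Remark 3 (p. 18, `q_a ∈ [0,1]`)] -/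
theorem sum_ζ (ht0 : 0 < L.t) (ht1 : L.t ≤ 1) (τa : Fin w → Option Bool) :
    ∑ ϱ : Fin w → Option Bool, L.ζ τa ϱ = 1 := by
  classical
  unfold ζ
  split_ifs with hc
  · have hn : (stars τa).card ≠ 0 := hc.2.2
    set n := (stars τa).card with hn'
    have hD : (1 : ℝ) - (1 - L.t) ^ n ≠ 0 := by
      have : (1 - L.t) ^ n < 1 := pow_lt_one₀ (by linarith) (by linarith) hn
      linarith
    have hind : ∑ ϱ : Fin w → Option Bool, L.ind τa ϱ = 1 := by
      simp only [ind]; rw [Finset.sum_ite_eq' univ (L.allo τa) (fun _ => (1 : ℝ))]; simp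
    simp only [Finset.sum_add_distrib, ← Finset.mul_sum, Finset.sum_sub_distrib, sum_prodW, sum_L2, sum_L3, hind,
      one_pow, mul_one]
    field_simp
    ring
  · rw [sum_prodW, sum_L3, one_pow]

/-- In case 1 the law is the bullet product law. [cite: RossmanServedioTan2015, §7.2 Def. 9 (p. 18, first bullet)] -/
theorem ζ_case1 {τa : Fin w → Option Bool} (h : ¬ L.Case2 τa) (ϱ : Fin w → Option Bool) :
    L.ζ τa ϱ = prodW τa L.L3 ϱ := by
  unfold ζ; rw [if_neg h]

/-- **Branch 1**: the all-`∘` refinement has weight `λ`. [cite: RossmanServedioTan2015, §7.2 Def. 9 (p. 18, eq. (12), first line)] -/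
theorem ζ_allo {τa : Fin w → Option Bool} (h : L.Case2 τa) : L.ζ τa (L.allo τa) = L.lam := by
  unfold ζ
  rw [if_pos h, L.prodW_L2_allo, L.prodW_L3_allo]
  simp [ind]

/-- Off the all-`∘` string the indicator vanishes. [folklore] -/
theorem ind_of_ne {τa ϱ : Fin w → Option Bool} (h : ϱ ≠ L.allo τa) : L.ind τa ϱ = 0 := by
  simp [ind, h]

/-- A refinement with a star is not the all-`∘` string. [folklore] -/
theorem ne_allo_of_star {τa ϱ : Fin w → Option Bool} {i : Fin w} (hs : ϱ i = none) : ϱ ≠ L.allo τa := by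
  intro h; rw [h] at hs; exact (Option.some_ne_none _) hs

/-- **Branch 2**: in case 2 a refinement with a star and no bullet on the stars has weight
`q · ∏_{i∈S} L2(ϱ_i) / (1 - (1-t)^n)`. [cite: RossmanServedioTan2015, §9.5 Fact 5 (p. 27, second line)] -/
theorem ζ_of_star {τa ϱ : Fin w → Option Bool} (h : L.Case2 τa) {i : Fin w} (hs : ϱ i = none) :
    L.ζ τa ϱ = L.qa (stars τa).card / (1 - (1 - L.t) ^ (stars τa).card) * prodW τa L.L2 ϱ := by
  unfold ζ
  rw [if_pos h, L.ind_of_ne (L.ne_allo_of_star hs)]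
  by_cases href : Refines ϱ τa
  · have hi : τa i = none := by
      by_contra hne
      have := href i hne
      rw [hs] at this
      exact hne this.symm
    rw [prodW_eq_zero_of_letter (Lf := L.L3) hi (by rw [hs]; rfl)]
    ring
  · rw [prodW_eq_zero_of_not_refines href, prodW_eq_zero_of_not_refines href]
    ring

/-- **Branch 3**: in case 2 a total refinement other than the all-`∘` string has weight
`(1 - λ - q) · ∏_{i∈S} L3(ϱ_i) / (1 - (1-t)^n)`. [cite: RossmanServedioTan2015, §9.5 Fact 5 (p. 27, third line)] -/
theorem ζ_of_total {τa ϱ : Fin w → Option Bool} (h : L.Case2 τa) (htot : ∀ i, ϱ i ≠ none)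
    (hne : ϱ ≠ L.allo τa) :
    L.ζ τa ϱ = (1 - L.lam - L.qa (stars τa).card) / (1 - (1 - L.t) ^ (stars τa).card) * prodW τa L.L3 ϱ := by
  classical
  unfold ζ
  rw [if_pos h, L.ind_of_ne hne]
  have h2 : prodW τa L.L2 ϱ = 0 := by
    by_cases href : Refines ϱ τa
    · -- a total refinement other than `allo` has a bullet on a star
      by_contra h0
      apply hne
      funext i
      unfold allo
      cases hτ : τa i with
      | some b => rw [href i (by rw [hτ]; exact Option.some_ne_none b), hτ]; rfl
      | none =>
        cases hϱ : ϱ i with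
        | none => exact absurd hϱ (htot i)
        | some b =>
          by_cases hb : b = L.o
          · rw [hb]; rfl
          · exfalso; apply h0
            exact prodW_eq_zero_of_letter (Lf := L.L2) hτ (by rw [hϱ]; simp [L2, hb])
    · exact prodW_eq_zero_of_not_refines href _
  rw [h2]
  ring

/-- Letter weights are nonnegative for `0 ≤ t ≤ 1`. [folklore] -/
theorem L2_nonneg (ht0 : 0 ≤ L.t) (ht1 : L.t ≤ 1) (c : Option Bool) : 0 ≤ L.L2 c := by
  rcases c with _ | b <;> simp only [L2]
  · exact ht0
  · split_ifs <;> linarith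

/-- Letter weights are nonnegative for `0 ≤ t ≤ 1`. [folklore] -/
theorem L3_nonneg (ht0 : 0 ≤ L.t) (ht1 : L.t ≤ 1) (c : Option Bool) : 0 ≤ L.L3 c := by
  rcases c with _ | b <;> simp only [L3]
  · exact le_rfl
  · split_ifs <;> linarith

/-- **Nonnegativity** of the block law, for `0 < t ≤ 1`, `0 ≤ λ` and `0 ≤ q ≤ 1 - λ` at acceptable
sizes (RST Remark 3: "`q_a` is a well-defined quantity in `[0,1]` if `S_a` is acceptable").
[cite: RossmanServedioTan2015, §7.2 Remark 3 (p. 18)] -/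
theorem ζ_nonneg (ht0 : 0 < L.t) (ht1 : L.t ≤ 1) (hlam : 0 ≤ L.lam)
    (hq : ∀ n, L.acc n = true → 1 ≤ n → 0 ≤ L.qa n ∧ L.qa n ≤ 1 - L.lam) (τa ϱ : Fin w → Option Bool) :
    0 ≤ L.ζ τa ϱ := by
  classical
  by_cases hc : L.Case2 τa
  · have hn1 : 1 ≤ (stars τa).card := Nat.one_le_iff_ne_zero.2 hc.2.2
    obtain ⟨hq0, hq1⟩ := hq _ hc.2.1 hn1
    have hD : 0 < (1 : ℝ) - (1 - L.t) ^ (stars τa).card := by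
      have : (1 - L.t) ^ (stars τa).card < 1 := pow_lt_one₀ (by linarith) (by linarith) hc.2.2
      linarith
    by_cases hϱ : ϱ = L.allo τa
    · rw [hϱ, L.ζ_allo hc]; exact hlam
    · unfold ζ
      rw [if_pos hc, L.ind_of_ne hϱ]
      simp only [mul_zero, sub_zero, zero_add]
      have h2 := prodW_nonneg τa (L.L2_nonneg ht0.le ht1) ϱ
      have h3 := prodW_nonneg τa (L.L3_nonneg ht0.le ht1) ϱ
      have : 0 ≤ 1 - L.lam - L.qa (stars τa).card := by linarith
      positivity
  · rw [L.ζ_case1 hc]; exact prodW_nonneg τa (L.L3_nonneg ht0.le ht1) ϱ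

/-! #### Support -/

/-- A string of nonzero weight refines the block. [cite: RossmanServedioTan2015, §7.2 Def. 9 (p. 18, "a distribution over refinements of `τ`")] -/
theorem refines_of_ζ_ne_zero {τa ϱ : Fin w → Option Bool} (h : L.ζ τa ϱ ≠ 0) : Refines ϱ τa := by
  by_contra href
  apply h
  have hne : ϱ ≠ L.allo τa := fun e => href (e ▸ L.allo_refines τa)
  unfold ζ
  split_ifs
  · rw [L.ind_of_ne hne, prodW_eq_zero_of_not_refines href, prodW_eq_zero_of_not_refines href]; ring
  · exact prodW_eq_zero_of_not_refines href _

/-- A string of nonzero weight with a star is in case 2. [cite: RossmanServedioTan2015, §7.2 Remark 4 (p. 18)] -/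
theorem case2_of_ζ_ne_zero_of_star {τa ϱ : Fin w → Option Bool} (h : L.ζ τa ϱ ≠ 0) {i : Fin w}
    (hs : ϱ i = none) : L.Case2 τa := by
  by_contra hc
  rw [L.ζ_case1 hc] at h
  have href := L.refines_of_ζ_ne_zero (by rwa [L.ζ_case1 hc])
  have hi : τa i = none := by
    by_contra hne; have := href i hne; rw [hs] at this; exact hne this.symm
  exact h (prodW_eq_zero_of_letter hi (by rw [hs]; rfl))

/-- **Support property** (hypothesis (support) of the projection switching lemma; RST §9.3
(ii)–(iv), Remark 4): a block string of nonzero weight containing a star contains no bullet.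
[cite: RossmanServedioTan2015, §9.3 (p. 25, (ii)–(iv)) and §7.2 Remark 4 (p. 18)] -/
theorem no_bullet_of_ζ_ne_zero_of_star {τa ϱ : Fin w → Option Bool} (h : L.ζ τa ϱ ≠ 0) {i : Fin w}
    (hs : ϱ i = none) (j : Fin w) : ϱ j ≠ some (!L.o) := by
  classical
  intro hj
  have hc := L.case2_of_ζ_ne_zero_of_star h hs
  have href := L.refines_of_ζ_ne_zero h
  -- `j` is a star of `τa` (off the stars `ϱ = τa` has no bullet in case 2)
  have hτj : τa j = none := by
    by_contra hne
    have := href j hne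
    rw [hj] at this
    exact hc.1 j this.symm
  apply h
  rw [L.ζ_of_star hc hs, prodW_eq_zero_of_letter (Lf := L.L2) hτj (by rw [hj]; simp [L2])]
  ring

/-! #### Weight ratios (hypothesis (ratio) of the projection switching lemma) -/

/-- The number of bullets of a string on the stars of the block. [folklore] -/
def bullets (τa ϱ : Fin w → Option Bool) : ℕ := ((stars τa).filter fun i => ϱ i = some (!L.o)).card

/-- The number of stars of a string (on the stars of the block). [folklore] -/
def nstars (τa ϱ : Fin w → Option Bool) : ℕ := ((stars τa).filter fun i => ϱ i = none).card

/-- Product weight `L2` of a refinement without bullets: `t^{#⋆} (1-t)^{#∘}`. [cite: RossmanServedioTan2015, §9.5 Fact 5 (p. 27)] -/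
theorem prodW_L2_eq {τa ϱ : Fin w → Option Bool} (href : Refines ϱ τa) (hnb : ∀ i, ϱ i ≠ some (!L.o)) :
    prodW τa L.L2 ϱ = L.t ^ nstars τa ϱ * (1 - L.t) ^ ((stars τa).card - nstars τa ϱ) := by
  classical
  rw [prodW_of_refines href]
  have key : ∀ i ∈ stars τa, L.L2 (ϱ i) = if ϱ i = none then L.t else 1 - L.t := by
    intro i _
    cases hϱ : ϱ i with
    | none => rfl
    | some b =>
      have hb : b = L.o := by
        by_contra hb
        have : b = !L.o := by cases b <;> cases ho : L.o <;> simp_all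
        exact hnb i (by rw [hϱ, this])
      simp [L2, hb]
  rw [Finset.prod_congr rfl key, Finset.prod_ite, Finset.prod_const, Finset.prod_const, nstars]
  congr 2
  have := Finset.card_filter_add_card_filter_not (s := stars τa) (p := fun i => ϱ i = none)
  omega

/-- Product weight `L3` of a total refinement: `t^{#•} (1-t)^{#∘}`. [cite: RossmanServedioTan2015, §9.5 Fact 5 (p. 27)] -/
theorem prodW_L3_eq {τa ϱ : Fin w → Option Bool} (href : Refines ϱ τa) (htot : ∀ i, ϱ i ≠ none) :
    prodW τa L.L3 ϱ = L.t ^ L.bullets τa ϱ * (1 - L.t) ^ ((stars τa).card - L.bullets τa ϱ) := by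
  classical
  rw [prodW_of_refines href]
  have key : ∀ i ∈ stars τa, L.L3 (ϱ i) = if ϱ i = some (!L.o) then L.t else 1 - L.t := by
    intro i _
    cases hϱ : ϱ i with
    | none => exact absurd hϱ (htot i)
    | some b =>
      by_cases hb : b = L.o
      · subst hb; simp [L3]
      · have : b = !L.o := by cases b <;> cases ho : L.o <;> simp_all
        subst this; cases ho : L.o <;> simp [L3, ho]
  rw [Finset.prod_congr rfl key, Finset.prod_ite, Finset.prod_const, Finset.prod_const, bullets]
  congr 2
  have := Finset.card_filter_add_card_filter_not (s := stars τa) (p := fun i => ϱ i = some (!L.o))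
  omega

/-- A refinement's stars are stars of the block. [folklore] -/
theorem star_of_refines {τa ϱ : Fin w → Option Bool} (href : Refines ϱ τa) {i : Fin w} (hs : ϱ i = none) :
    τa i = none := by
  by_contra hne
  have := href i hne
  rw [hs] at this
  exact hne this.symm

/-- **Weight ratios** (hypothesis (ratio) of the projection switching lemma; RST eq. (18) and the
two displays after it): completing the stars of a block string of positive weight multiplies its
weight by at least `Γ · ((1-t)/t)^{#new ∘}`, as soon as `Γ q ≤ 1 - λ - q` and `Γ q (1-t)^n ≤
λ (1 - (1-t)^n)` at every acceptable size `n ≥ 1` (RST: `Γ = Ω(w^{1/4})`). [cite: RossmanServedioTan2015, §9.5 (p. 28, eq. (18))] -/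
theorem ratio_of_star (ht0 : 0 < L.t) (ht1 : L.t < 1) {Γ : ℝ}
    (hq : ∀ n, L.acc n = true → 1 ≤ n →
      0 < L.qa n ∧ Γ * L.qa n ≤ 1 - L.lam - L.qa n ∧ Γ * L.qa n * (1 - L.t) ^ n ≤ L.lam * (1 - (1 - L.t) ^ n))
    {τa ϱ : Fin w → Option Bool} (hpos : 0 < L.ζ τa ϱ) (hstar : ∃ i, ϱ i = none) (g : Fin w → Bool) :
    Γ * ((1 - L.t) / L.t) ^ (univ.filter fun i => ϱ i = none ∧ g i = L.o).card * L.ζ τa ϱ ≤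
      L.ζ τa (fun i => some ((ϱ i).getD (g i))) := by
  classical
  obtain ⟨i₀, hi₀⟩ := hstar
  have hc : L.Case2 τa := L.case2_of_ζ_ne_zero_of_star hpos.ne' hi₀
  have href : Refines ϱ τa := L.refines_of_ζ_ne_zero hpos.ne'
  have hnb : ∀ i, ϱ i ≠ some (!L.o) := L.no_bullet_of_ζ_ne_zero_of_star hpos.ne' hi₀
  set n := (stars τa).card with hn
  have hn1 : 1 ≤ n := Nat.one_le_iff_ne_zero.2 hc.2.2
  obtain ⟨hq0, hq1, hq2⟩ := hq n hc.2.1 hn1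
  set S := stars τa with hS
  set ϱ' : Fin w → Option Bool := fun i => some ((ϱ i).getD (g i)) with hϱ'
  -- counts
  set u := nstars τa ϱ with hu
  set Δ := (univ.filter fun i => ϱ i = none ∧ g i = L.o).card with hΔ
  set bl := L.bullets τa ϱ' with hbl
  have hΔS : Δ = ((S.filter fun i => ϱ i = none).filter fun i => g i = L.o).card := by
    rw [hΔ, Finset.filter_filter]
    congr 1; ext i
    simp only [Finset.mem_filter, Finset.mem_univ, true_and, hS, mem_stars]
    constructor
    · rintro ⟨h1, h2⟩; exact ⟨star_of_refines href h1, h1, h2⟩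
    · rintro ⟨_, h1, h2⟩; exact ⟨h1, h2⟩
  have hblS : bl = ((S.filter fun i => ϱ i = none).filter fun i => ¬ g i = L.o).card := by
    rw [hbl, bullets, Finset.filter_filter]
    congr 1; ext i
    simp only [Finset.mem_filter, hϱ']
    constructor
    · rintro ⟨hi, he⟩
      refine ⟨hi, ?_⟩
      cases hϱi : ϱ i with
      | none =>
        rw [hϱi] at he; simp only [Option.getD_none, Option.some.injEq] at he
        refine ⟨rfl, ?_⟩; rw [he]; cases L.o <;> decide
      | some b => rw [hϱi] at he; exact absurd (hϱi.trans (by simpa using he)) (hnb i)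
    · rintro ⟨hi, hnone, hg⟩
      refine ⟨hi, ?_⟩
      rw [hnone]
      simp only [Option.getD_none, Option.some.injEq]
      cases hgi : g i <;> cases ho : L.o <;> simp_all
  have hsum : bl + Δ = u := by
    rw [hblS, hΔS, hu, nstars, add_comm]
    exact Finset.card_filter_add_card_filter_not _
  have hun : u ≤ n := by rw [hu, nstars, hn]; exact Finset.card_filter_le _ _
  -- the weight of `ϱ`
  have hζ : L.ζ τa ϱ = L.qa n / (1 - (1 - L.t) ^ n) * (L.t ^ u * (1 - L.t) ^ (n - u)) := by
    rw [L.ζ_of_star hc hi₀, L.prodW_L2_eq href hnb]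
  have href' : Refines ϱ' τa := fun i hi => by
    simp only [hϱ']; rw [href i hi]
    cases h : τa i with
    | none => exact absurd h hi
    | some b => rfl
  have htot' : ∀ i, ϱ' i ≠ none := fun i => Option.some_ne_none _
  have h1t : 0 < 1 - L.t := by linarith
  have hD : 0 < 1 - (1 - L.t) ^ n := by
    have : (1 - L.t) ^ n < 1 := pow_lt_one₀ h1t.le (by linarith) (by omega)
    linarith
  have hκt : ((1 - L.t) / L.t) ^ Δ * L.t ^ u * (1 - L.t) ^ (n - u) = L.t ^ bl * (1 - L.t) ^ (n - bl) := by
    have e2 : n - bl = (n - u) + Δ := by omega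
    rw [e2]
    generalize n - u = k
    have ht0' : L.t ≠ 0 := ht0.ne'
    rw [← hsum, pow_add, pow_add, div_pow]
    field_simp
  by_cases hΔu : Δ = u
  · -- every star goes to `∘`: the completion is the all-`∘` string, of weight `λ`
    have hbl0 : bl = 0 := by omega
    have hnobul : ∀ i ∈ S, ϱ' i ≠ some (!L.o) := by
      intro i hi hb
      have hmem : i ∈ S.filter (fun i => ϱ' i = some (!L.o)) := Finset.mem_filter.2 ⟨hi, hb⟩
      have : 0 < bl := by rw [hbl]; unfold bullets; exact Finset.card_pos.2 ⟨i, hmem⟩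
      omega
    have hall : ϱ' = L.allo τa := by
      funext i
      cases hτ : τa i with
      | some b =>
        have e := href' i (by rw [hτ]; exact Option.some_ne_none b)
        rw [e, hτ]; simp [allo, hτ]
      | none =>
        have hi : i ∈ S := by rw [hS, mem_stars]; exact hτ
        have hnb' := hnobul i hi
        rw [L.allo_of_none hτ]
        simp only [hϱ'] at hnb' ⊢
        cases hv : (ϱ i).getD (g i) <;> cases ho : L.o <;> simp_all
    rw [hall, L.ζ_allo hc, hζ]
    have key : Γ * ((1 - L.t) / L.t) ^ Δ * (L.qa n / (1 - (1 - L.t) ^ n) * (L.t ^ u * (1 - L.t) ^ (n - u))) =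
        Γ * L.qa n * (1 - L.t) ^ n / (1 - (1 - L.t) ^ n) := by
      have : ((1 - L.t) / L.t) ^ Δ * (L.t ^ u * (1 - L.t) ^ (n - u)) = (1 - L.t) ^ n := by
        rw [← mul_assoc, hκt, hbl0, pow_zero, one_mul, Nat.sub_zero]
      calc _ = Γ * (L.qa n / (1 - (1 - L.t) ^ n)) * (((1 - L.t) / L.t) ^ Δ * (L.t ^ u * (1 - L.t) ^ (n - u))) := by ring
        _ = _ := by rw [this]; field_simp
    rw [key, div_le_iff₀ hD]
    exact hq2
  · -- a bullet appears: the completion is a total string other than the all-`∘` one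
    have hΔlt : Δ < u := lt_of_le_of_ne (by omega) hΔu
    have hne : ϱ' ≠ L.allo τa := by
      intro hall
      have hblpos : 0 < bl := by omega
      rw [hbl] at hblpos
      unfold bullets at hblpos
      obtain ⟨i, hi⟩ := Finset.card_pos.1 hblpos
      rw [Finset.mem_filter] at hi
      rw [hall, L.allo_of_none (mem_stars.1 hi.1)] at hi
      have := hi.2
      simp only [Option.some.injEq] at this
      cases hb : L.o <;> rw [hb] at this <;> simp at this
    rw [L.ζ_of_total hc htot' hne, L.prodW_L3_eq href' htot', ← hbl, hζ]
    calc Γ * ((1 - L.t) / L.t) ^ Δ * (L.qa n / (1 - (1 - L.t) ^ n) * (L.t ^ u * (1 - L.t) ^ (n - u)))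
        = Γ * L.qa n / (1 - (1 - L.t) ^ n) * (((1 - L.t) / L.t) ^ Δ * L.t ^ u * (1 - L.t) ^ (n - u)) := by ring
      _ = Γ * L.qa n / (1 - (1 - L.t) ^ n) * (L.t ^ bl * (1 - L.t) ^ (n - bl)) := by rw [hκt]
      _ ≤ (1 - L.lam - L.qa n) / (1 - (1 - L.t) ^ n) * (L.t ^ bl * (1 - L.t) ^ (n - bl)) := by
          refine mul_le_mul_of_nonneg_right ?_ (by positivity)
          exact div_le_div_of_nonneg_right hq1 hD.le

/-! #### The block coupling identity (RST §8, Lemmas 2 and 3, on one block) -/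

/-- The probability, over the independent bit `b` with `P[b = ∘] = t'`, that filling the stars of
`ϱ` with `b` gives the string `za`. [cite: RossmanServedioTan2015, §8 (p. 20–21, `Z_{a,i} = Y_a if ρ_{a,i} = ⋆`)] -/
def cpl (za : Fin w → Bool) (ϱ : Fin w → Option Bool) : ℝ :=
  ∑ b : Bool, (if b = L.o then L.t' else 1 - L.t') * (if (∀ i, (ϱ i).getD b = za i) then 1 else 0)

/-- For a total string, filling does nothing: the probability is the indicator of `ϱ = za`. [folklore] -/
theorem cpl_of_total {za : Fin w → Bool} {ϱ : Fin w → Option Bool} (htot : ∀ i, ϱ i ≠ none) :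
    L.cpl za ϱ = if ϱ = (fun i => some (za i)) then 1 else 0 := by
  classical
  have key : ∀ b : Bool, (∀ i, (ϱ i).getD b = za i) ↔ ϱ = fun i => some (za i) := by
    intro b
    constructor
    · intro h; funext i
      cases hϱ : ϱ i with
      | none => exact absurd hϱ (htot i)
      | some c => have := h i; rw [hϱ] at this; simpa using this
    · intro h i; rw [h]; rfl
  unfold cpl
  simp only [key]
  rw [Fintype.sum_bool]
  by_cases h : ϱ = (fun i => some (za i))
  · cases ho : L.o <;> simp [h]
  · simp [h]

/-- `Σ_ϱ L3(ϱ) P[fill = za] = L3(za)`: the bullet product law has no stars to fill. [folklore] -/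
theorem sum_prodW_L3_mul_cpl (τa : Fin w → Option Bool) (za : Fin w → Bool) :
    ∑ ϱ : Fin w → Option Bool, prodW τa L.L3 ϱ * L.cpl za ϱ = prodW τa L.L3 (fun i => some (za i)) := by
  classical
  have key : ∀ ϱ : Fin w → Option Bool, prodW τa L.L3 ϱ * L.cpl za ϱ =
      if ϱ = (fun i => some (za i)) then prodW τa L.L3 (fun i => some (za i)) else 0 := by
    intro ϱ
    by_cases htot : ∀ i, ϱ i ≠ none
    · rw [L.cpl_of_total htot]
      split_ifs with h
      · rw [h, mul_one]
      · rw [mul_zero]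
    · push Not at htot
      obtain ⟨i, hi⟩ := htot
      have h0 : prodW τa L.L3 ϱ = 0 := by
        by_cases href : Refines ϱ τa
        · exact prodW_eq_zero_of_letter (star_of_refines href hi) (by rw [hi]; rfl)
        · exact prodW_eq_zero_of_not_refines href _
      rw [h0, zero_mul, if_neg]
      intro h; rw [h] at hi; exact (Option.some_ne_none _) hi
  rw [Finset.sum_congr rfl fun ϱ _ => key ϱ, Finset.sum_ite_eq' univ]
  simp

/-- The unique starred string whose filling by `•` gives `za`: stars exactly at the bullets of `za`
on the stars of the block. [cite: RossmanServedioTan2015, §8 Lemma 3 (p. 21, proof)] -/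
def starOf (τa : Fin w → Option Bool) (za : Fin w → Bool) : Fin w → Option Bool :=
  fun i => if τa i = none ∧ za i = !L.o then none else some (za i)

/-- `L2` of the starred preimage equals `L3` of the target (`⋆ ↔ •` both weigh `t`, `∘` weighs `1-t`). [cite: RossmanServedioTan2015, §8 (p. 21, eq. after "for any string Z")] -/
theorem prodW_L2_starOf (τa : Fin w → Option Bool) (za : Fin w → Bool) :
    prodW τa L.L2 (L.starOf τa za) = prodW τa L.L3 (fun i => some (za i)) := by
  classical
  by_cases href : Refines (fun i => some (za i)) τa
  · have href' : Refines (L.starOf τa za) τa := by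
      intro i hi
      show (if τa i = none ∧ za i = !L.o then none else some (za i)) = τa i
      rw [if_neg (fun h : τa i = none ∧ za i = !L.o => hi h.1)]
      exact href i hi
    rw [prodW_of_refines href, prodW_of_refines href']
    refine Finset.prod_congr rfl fun i hi => ?_
    have hτ := mem_stars.1 hi
    simp only [starOf, hτ, true_and]
    by_cases hz : za i = !L.o
    · rw [if_pos hz, hz]; cases ho : L.o <;> simp [L2, L3, ho]
    · rw [if_neg hz]
      have : za i = L.o := by cases hzi : za i <;> cases ho : L.o <;> simp_all
      simp [L2, L3, this]
  · have href' : ¬ Refines (L.starOf τa za) τa := by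
      intro h; apply href; intro i hi
      have := h i hi
      change (if τa i = none ∧ za i = !L.o then none else some (za i)) = τa i at this
      rw [if_neg (fun h' : τa i = none ∧ za i = !L.o => hi h'.1)] at this
      exact this
    rw [prodW_eq_zero_of_not_refines href, prodW_eq_zero_of_not_refines href']

/-- Filling by `∘` a string of the starred branch gives the all-`∘` string; so
`Σ_ϱ L2(ϱ) [fill(ϱ, ∘) = za] = [za = all-∘]`. [cite: RossmanServedioTan2015, §8 (p. 21, "`Pr[Z_a = 1^{S_a}] = λ + q_a Pr[Y_a = 1]`")] -/
theorem sum_prodW_L2_fill_o (τa : Fin w → Option Bool) (za : Fin w → Bool) :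
    ∑ ϱ : Fin w → Option Bool, prodW τa L.L2 ϱ * (if (∀ i, (ϱ i).getD L.o = za i) then 1 else 0) =
      if (fun i => some (za i)) = L.allo τa then 1 else 0 := by
  classical
  have key : ∀ ϱ : Fin w → Option Bool, prodW τa L.L2 ϱ * (if (∀ i, (ϱ i).getD L.o = za i) then 1 else 0) =
      prodW τa L.L2 ϱ * (if (fun i => some (za i)) = L.allo τa then 1 else 0) := by
    intro ϱ
    by_cases h0 : prodW τa L.L2 ϱ = 0
    · rw [h0, zero_mul, zero_mul]
    · have href : Refines ϱ τa := by
        by_contra h; exact h0 (prodW_eq_zero_of_not_refines h _)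
      -- on the support of `L2`, filling by `∘` gives `allo`
      have hfill : (fun i => some ((ϱ i).getD L.o)) = L.allo τa := by
        funext i
        simp only [allo]
        cases hτ : τa i with
        | some b => rw [href i (by rw [hτ]; exact Option.some_ne_none b), hτ]
        | none =>
          cases hϱ : ϱ i with
          | none => rfl
          | some b =>
            by_cases hb : b = L.o
            · rw [hb]; rfl
            · exact absurd (prodW_eq_zero_of_letter (Lf := L.L2) hτ (by rw [hϱ]; simp [L2, hb])) h0
      congr 1
      have : (∀ i, (ϱ i).getD L.o = za i) ↔ (fun i => some (za i)) = L.allo τa := by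
        rw [← hfill]
        constructor
        · intro h; funext i; rw [h i]
        · intro h i; have := congrFun h i; simpa using this.symm
      simp only [this]
  rw [Finset.sum_congr rfl fun ϱ _ => key ϱ, ← Finset.sum_mul, sum_prodW, L.sum_L2, one_pow, one_mul]

/-- Filling by `•` a string of the starred branch: `Σ_ϱ L2(ϱ) [fill(ϱ, •) = za] = L3(za)`. [cite: RossmanServedioTan2015, §8 Lemma 3 (p. 21, proof, eq. (15))] -/
theorem sum_prodW_L2_fill_bullet (τa : Fin w → Option Bool) (za : Fin w → Bool) :
    ∑ ϱ : Fin w → Option Bool, prodW τa L.L2 ϱ * (if (∀ i, (ϱ i).getD (!L.o) = za i) then 1 else 0) =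
      prodW τa L.L3 (fun i => some (za i)) := by
  classical
  have key : ∀ ϱ : Fin w → Option Bool, prodW τa L.L2 ϱ * (if (∀ i, (ϱ i).getD (!L.o) = za i) then 1 else 0) =
      if ϱ = L.starOf τa za then prodW τa L.L2 (L.starOf τa za) else 0 := by
    intro ϱ
    by_cases h0 : prodW τa L.L2 ϱ = 0
    · rw [h0, zero_mul]; split_ifs with h
      · rw [← h, h0]
      · rfl
    · have href : Refines ϱ τa := by
        by_contra h; exact h0 (prodW_eq_zero_of_not_refines h _)
      have hnb : ∀ i, τa i = none → ϱ i ≠ some (!L.o) := fun i hτ hb =>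
        h0 (prodW_eq_zero_of_letter (Lf := L.L2) hτ (by rw [hb]; simp [L2]))
      have hiff : (∀ i, (ϱ i).getD (!L.o) = za i) ↔ ϱ = L.starOf τa za := by
        constructor
        · intro h; funext i
          have hi := h i
          simp only [starOf]
          cases hϱ : ϱ i with
          | none =>
            rw [hϱ] at hi; simp only [Option.getD_none] at hi
            rw [if_pos ⟨star_of_refines href hϱ, hi.symm⟩]
          | some b =>
            rw [hϱ] at hi; simp only [Option.getD_some] at hi
            subst hi
            rw [if_neg]
            rintro ⟨hτ, hb⟩
            exact hnb i hτ (by rw [hϱ, hb])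
        · intro h i
          rw [h]
          simp only [starOf]
          split_ifs with hc
          · simpa using hc.2.symm
          · rfl
      by_cases hϱ : ϱ = L.starOf τa za
      · rw [if_pos (hiff.2 hϱ), if_pos hϱ, mul_one, hϱ]
      · rw [if_neg (fun h => hϱ (hiff.1 h)), if_neg hϱ, mul_zero]
  rw [Finset.sum_congr rfl fun ϱ _ => key ϱ, Finset.sum_ite_eq' univ]
  simp [L.prodW_L2_starOf]

/-- `Σ_ϱ L2(ϱ) P[fill = za] = t' [za = all-∘] + (1 - t') L3(za)`. [cite: RossmanServedioTan2015, §8 (p. 21)] -/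
theorem sum_prodW_L2_mul_cpl (τa : Fin w → Option Bool) (za : Fin w → Bool) :
    ∑ ϱ : Fin w → Option Bool, prodW τa L.L2 ϱ * L.cpl za ϱ =
      L.t' * (if (fun i => some (za i)) = L.allo τa then 1 else 0) + (1 - L.t') * prodW τa L.L3 (fun i => some (za i)) := by
  classical
  unfold cpl
  simp only [Fintype.sum_bool, mul_add, Finset.sum_add_distrib]
  have e1 : ∀ ϱ : Fin w → Option Bool, prodW τa L.L2 ϱ * ((if true = L.o then L.t' else 1 - L.t') *
      if (∀ i, (ϱ i).getD true = za i) then 1 else 0) =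
      (if true = L.o then L.t' else 1 - L.t') * (prodW τa L.L2 ϱ * if (∀ i, (ϱ i).getD true = za i) then 1 else 0) :=
    fun ϱ => by ring
  have e2 : ∀ ϱ : Fin w → Option Bool, prodW τa L.L2 ϱ * ((if false = L.o then L.t' else 1 - L.t') *
      if (∀ i, (ϱ i).getD false = za i) then 1 else 0) =
      (if false = L.o then L.t' else 1 - L.t') * (prodW τa L.L2 ϱ * if (∀ i, (ϱ i).getD false = za i) then 1 else 0) :=
    fun ϱ => by ring
  rw [Finset.sum_congr rfl fun ϱ _ => e1 ϱ, Finset.sum_congr rfl fun ϱ _ => e2 ϱ, ← Finset.mul_sum, ← Finset.mul_sum]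
  cases ho : L.o
  · have h1 := L.sum_prodW_L2_fill_bullet τa za
    have h2 := L.sum_prodW_L2_fill_o τa za
    rw [ho] at h1 h2
    simp only [Bool.not_false] at h1
    rw [h1, h2]
    simp; ring
  · have h1 := L.sum_prodW_L2_fill_bullet τa za
    have h2 := L.sum_prodW_L2_fill_o τa za
    rw [ho] at h1 h2
    simp only [Bool.not_true] at h1
    rw [h1, h2]
    simp

/-- `Σ_ϱ [ϱ = allo] P[fill = za] = [za = all-∘]`. [folklore] -/
theorem sum_ind_mul_cpl (τa : Fin w → Option Bool) (za : Fin w → Bool) :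
    ∑ ϱ : Fin w → Option Bool, L.ind τa ϱ * L.cpl za ϱ = if (fun i => some (za i)) = L.allo τa then 1 else 0 := by
  classical
  simp only [ind, ite_mul, one_mul, zero_mul]
  rw [Finset.sum_ite_eq' univ]
  simp only [Finset.mem_univ, if_true]
  rw [L.cpl_of_total (fun i => by simp [allo])]
  by_cases h : (fun i => some (za i)) = L.allo τa
  · rw [if_pos h, if_pos h.symm]
  · rw [if_neg h, if_neg (fun h' => h h'.symm)]

/-- **Block coupling identity** (RST §8: Lemma 2 for `R_init`, Lemma 3 for `R(τ)`: "the string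
`Z_a` is distributed according to `{0_{t_k}, 1_{1-t_k}}^{S_a}`"): drawing the block string from `ζ`
and filling its stars with an independent bit of bias `t'` towards `∘` produces exactly the
`{•_t, ∘_{1-t}}` product law on the stars (deterministic elsewhere). This is where
`q t' = (1-t)^n - λ` (the definition of `q_a`, eq. (13); for `R_init` the definition of `t_{d-1}`,
eq. (11)) is used. [cite: RossmanServedioTan2015, §8 Lemmas 2 and 3 (pp. 20–21)] -/
theorem coupling (ht0 : 0 < L.t) (ht1 : L.t ≤ 1) (ht' : L.t' ≠ 0) (τa : Fin w → Option Bool)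
    (za : Fin w → Bool) :
    ∑ ϱ : Fin w → Option Bool, L.ζ τa ϱ * L.cpl za ϱ = prodW τa L.L3 (fun i => some (za i)) := by
  classical
  by_cases hc : L.Case2 τa
  · set n := (stars τa).card with hn
    set c := (1 - L.t) ^ n with hcdef
    have hD : (1 : ℝ) - c ≠ 0 := by
      have : c < 1 := pow_lt_one₀ (by linarith) (by linarith) hc.2.2
      linarith
    have hq : L.qa n * L.t' = c - L.lam := by
      unfold qa; field_simp; rw [hcdef]
    have expand : ∀ ϱ : Fin w → Option Bool, L.ζ τa ϱ * L.cpl za ϱ =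
        L.lam * (L.ind τa ϱ * L.cpl za ϱ)
        + L.qa n / (1 - c) * (prodW τa L.L2 ϱ * L.cpl za ϱ) - L.qa n / (1 - c) * c * (L.ind τa ϱ * L.cpl za ϱ)
        + (1 - L.lam - L.qa n) / (1 - c) * (prodW τa L.L3 ϱ * L.cpl za ϱ)
        - (1 - L.lam - L.qa n) / (1 - c) * c * (L.ind τa ϱ * L.cpl za ϱ) := by
      intro ϱ; unfold ζ; rw [if_pos hc]; ring
    rw [Finset.sum_congr rfl fun ϱ _ => expand ϱ]
    simp only [Finset.sum_add_distrib, Finset.sum_sub_distrib, ← Finset.mul_sum, L.sum_ind_mul_cpl,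
      L.sum_prodW_L2_mul_cpl, L.sum_prodW_L3_mul_cpl]
    by_cases hz : (fun i => some (za i)) = L.allo τa
    · simp only [if_pos hz]
      have h3 : prodW τa L.L3 (fun i => some (za i)) = c := by rw [hz, L.prodW_L3_allo]
      rw [h3]
      field_simp
      linear_combination (1 - c) * hq
    · simp only [if_neg hz, mul_zero, sub_zero, zero_add]
      rw [div_mul_eq_mul_div, div_mul_eq_mul_div, ← add_div, div_eq_iff hD]
      linear_combination (-(prodW τa L.L3 fun i => some (za i))) * hq
  · simp only [L.ζ_case1 hc]
    exact L.sum_prodW_L3_mul_cpl τa za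

end BlockLaw

end RSTProj

end Literature.Computability.Complexity

end
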